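import Summits.FinalStateConjecture.FinalStateConjecture.Statement
import Summits.FinalStateConjecture.FinalStateConjecture.Theorems.SoloBlindCausal
import Literature.Geometry.Lorentzian.CausalityOpennessProofs

/-!
# Solo (blind) — the causal skeleton of the focal-data argument against the typed conclusion

Kernel form of Steps 2 and 4 of Theorem B of `paper/focal-exceptional.md` (soloist
`solo-FinalStateConjecture-blind`), stated over the REAL clauses of the typed conjecture
(`Summit.FinalStateConjecture.RaysStayInClosure`, `….HasExhaustiveCharts`, `….certifiedLate`,
`….certifiedSlab`) for a Cauchy development `𝒟` carrying a holeless (`N = 0`) final state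
decomposition `d` of a region `O`.

`soloBlind_focal_contradiction`: suppose
* (rays) every future-complete normalised null ray from the data stays in `closure O` and
  (exhaustion) the charts of `d` exhaust `O` — two clauses of the typed conclusion;
* (focal event) a point `x` lies on a future-complete normalised null ray from the data at a
  parameter `t ≥ 0` — in the paper: a curvature spike of the development on the symmetry axis,
  reached by a past null geodesic from the Cauchy hypersurface, complete by hypothesis (H1);
* (separation) an open neighbourhood `B` of `x` misses the flat chart's image of `{x⁰ > τ₁}` — in
  the paper: curvature is `≥ 2` on `B` and `≤ 1` on late flat leaves by `C²`-convergence to `η`;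
* (late achronal leaf) for some chart time `τ₂ ≥ τ₁`, `τ₂ > τ₀`, the flat leaf
  `L = Ψ₀({x⁰ = τ₂} ∩ U₀)` is achronal and `x ∈ I⁺(L)` — in the paper: Step 3 (a complete
  `C⁰`-near-flat leaf is an entire achronal graph, and the central geodesic ends up above it).
Then `False`: `x ∈ closure O` (rays), so the open set `B ∩ I⁺(L)` meets `O` in a point `q`; `q` is
not in the certified late region after `τ₂` (which for `N = 0` is the flat image of `{x⁰ > τ₂}`
`⊆` that of `{x⁰ > τ₁}`, disjoint from `B`), so exhaustion at `τ₂` puts `q ∈ J⁻(L)`; but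
`q ∈ I⁺(L)` and `L` is achronal — push-up (`soloBlind_not_mem_causalPast_of_mem_chronologicalFuture`).

What stays analytic (hypotheses here): the focal event itself (Prop. 3 of the paper: nonlinear
survival of imploding Teukolsky-shell spikes), null completeness (H1), the curvature separation
(Step 1) and the achronal-graph property of late leaves (Step 3, from global `C⁰`-near-Minkowski
coordinates (H2)); and `N = 0` (Step 0, from (H3)).

References: B. O'Neill, *Semi-Riemannian geometry*, Academic Press 1983, Ch. 14, Lemma 14.3
(pp. 403–404: `I⁺(S)` open) and Cor. 14.1, p. 402, p. 413 (push-up, achronal sets);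
D. Christodoulou, CQG 16 (1999) A23, pp. A26–A27 (normalised null rays from the data).
-/

noncomputable section

open Literature.Geometry.Lorentzian Set
open scoped Manifold ContDiff Topology

set_option linter.dupNamespace false

namespace Summit.FinalStateConjecture.FinalStateConjecture.Theorems

section Holeless

variable {𝓢 : Spacetime.{0} 4} {O : Set 𝓢.carrier} {k : ℕ}

/-- With no holes (`N = 0`) the certified late region after `τ₁` is the flat chart's image of the
late flat region `{x⁰ > τ₁} ∩ U₀`, whatever the near-zone radii. Dafermos–Luk arXiv:1710.01722,
Conjecture 1 (b) (`N = 0`: dispersal; no near zones). -/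
theorem soloBlind_certifiedLate_of_N_eq_zero (d : FinalStateDecomposition 𝓢 O k) (hN : d.N = 0)
    (R : Fin d.N → ℝ → ℝ) (τ₁ : ℝ) :
    certifiedLate d R τ₁ = d.flatChart '' (Minkowski.backgroundOn d.flatDomain).lateRegion τ₁ := by
  haveI : IsEmpty (Fin d.N) := by rw [hN]; infer_instance
  rw [certifiedLate, iUnion_of_empty, union_empty]

/-- With no holes (`N = 0`) the certified slab at `τ₁` is the flat leaf `Ψ₀({x⁰ = τ₁} ∩ U₀)`.
Dafermos–Luk arXiv:1710.01722, Conjecture 1 (b) (`N = 0`). -/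
theorem soloBlind_certifiedSlab_of_N_eq_zero (d : FinalStateDecomposition 𝓢 O k) (hN : d.N = 0)
    (R : Fin d.N → ℝ → ℝ) (τ₁ : ℝ) :
    certifiedSlab d R τ₁ = d.flatChart '' (Minkowski.backgroundOn d.flatDomain).timeSlab τ₁ := by
  haveI : IsEmpty (Fin d.N) := by rw [hN]; infer_instance
  rw [certifiedSlab, iUnion_of_empty, union_empty]

/-- The late flat regions decrease in the chart time: `{x⁰ > τ₂} ⊆ {x⁰ > τ₁}` for `τ₁ ≤ τ₂`.
Christodoulou–Klainerman 1993, Ch. 1 (the `x⁰` foliation). -/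
theorem soloBlind_lateRegion_antitone (U : TopologicalSpace.Opens E4) {τ₁ τ₂ : ℝ} (h : τ₁ ≤ τ₂) :
    (Minkowski.backgroundOn U).lateRegion τ₂ ⊆ (Minkowski.backgroundOn U).lateRegion τ₁ :=
  fun _ hx ↦ lt_of_le_of_lt h hx

end Holeless

section Focal

variable {X : Type} [TopologicalSpace X] [ChartedSpace E3 X] [IsManifold (𝓡 3) ∞ X]
  [ConnectedSpace X] {D : InitialDataSet (𝓡 3) X}

/-- **Theorem B, Steps 2 and 4 (kernel skeleton).** For a Cauchy development `𝒟` of `D` and a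
holeless final state decomposition `d` of `O ⊆ 𝒟` satisfying the typed clauses
`RaysStayInClosure 𝒟 O` and `HasExhaustiveCharts d`: there is no point `x` which lies on a
future-complete normalised null ray from the data at a parameter `t ≥ 0`, has an open
neighbourhood `B` disjoint from the flat chart's image of `{x⁰ > τ₁}`, and lies in the
chronological future of an ACHRONAL flat leaf `Ψ₀({x⁰ = τ₂} ∩ U₀)` with `τ₀ < τ₂`, `τ₁ ≤ τ₂`.
(Rays put `x` in `closure O`; the open set `B ∩ I⁺(leaf)` then meets `O`; exhaustion at `τ₂` puts
that point in `J⁻(leaf)`; push-up contradicts achronality.) O'Neill 1983, Ch. 14, Lemma 14.3 and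
p. 413; Christodoulou, CQG 16 (1999) A23, pp. A26–A27. -/
theorem soloBlind_focal_contradiction (𝒟 : CauchyDevelopment D) [𝒟.metric.HasLeviCivita]
    {O : Set 𝒟.carrier} (d : FinalStateDecomposition 𝒟.toSpacetime O 2) (hN : d.N = 0)
    (hrays : RaysStayInClosure 𝒟 O) (hex : HasExhaustiveCharts d)
    {x : 𝒟.carrier} {p : X} {γ : ℝ → 𝒟.carrier} {dom : Set ℝ} {t : ℝ}
    (hγ : 𝒟.metric.IsNormalisedNullRayFrom 𝒟.timeOrientation 𝒟.embed 𝒟.normal p γ dom)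
    (hdom : ¬ BddAbove dom) (ht : t ∈ dom) (h0 : 0 ≤ t) (hx : γ t = x)
    {B : Set 𝒟.carrier} (hB : IsOpen B) (hxB : x ∈ B) {τ₁ τ₂ : ℝ} (h02 : d.τ₀ < τ₂)
    (h12 : τ₁ ≤ τ₂)
    (hdisj : Disjoint B (d.flatChart '' (Minkowski.backgroundOn d.flatDomain).lateRegion τ₁))
    (hA : 𝒟.metric.IsAchronal 𝒟.timeOrientation
      (d.flatChart '' (Minkowski.backgroundOn d.flatDomain).timeSlab τ₂))
    (hxI : x ∈ 𝒟.metric.chronologicalFuture 𝒟.timeOrientation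
      (d.flatChart '' (Minkowski.backgroundOn d.flatDomain).timeSlab τ₂)) :
    False := by
  set L := d.flatChart '' (Minkowski.backgroundOn d.flatDomain).timeSlab τ₂ with hL
  -- Step 2a: the focal event is in `closure O` (rays stay in the closed exterior).
  have hxcl : x ∈ closure O := hx ▸ hrays p γ dom hγ hdom t ht h0
  -- Step 2b: the open set `B ∩ I⁺(L)` contains `x`, hence meets `O`.
  have hU : IsOpen (B ∩ 𝒟.metric.chronologicalFuture 𝒟.timeOrientation L) :=
    hB.inter (LorentzianMetric.isOpen_chronologicalFuture_of_boundaryless _ _ L)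
  obtain ⟨q, ⟨hqB, hqI⟩, hqO⟩ := mem_closure_iff.1 hxcl _ hU ⟨hxB, hxI⟩
  -- Step 2c: `q` is not in the certified late region after `τ₂`, so exhaustion at `τ₂` applies.
  obtain ⟨R, -, -, hexh⟩ := hex
  have hqlate : q ∉ certifiedLate d R τ₂ := by
    rw [soloBlind_certifiedLate_of_N_eq_zero d hN]
    intro hq
    exact Set.disjoint_left.1 hdisj hqB
      (image_mono (soloBlind_lateRegion_antitone d.flatDomain h12) hq)
  have hqJ : q ∈ 𝒟.metric.causalPast 𝒟.timeOrientation L := by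
    have := hexh τ₂ h02 ⟨hqO, hqlate⟩
    rwa [soloBlind_certifiedSlab_of_N_eq_zero d hN] at this
  -- Step 4: push-up against the achronal leaf.
  exact soloBlind_not_mem_causalPast_of_mem_chronologicalFuture (by decide) hA hqI hqJ


/-- **The analytic input of Theorem B, packaged.** For the development `𝒟`: (i) no final state
decomposition of its self-determined exterior `O = J⁺(ι X) ∩ I⁻(charted)` with exhaustive
charts has a hole (`N = 0`; in the paper from
hypothesis (H3), no timelike curve of infinite proper time with Kretschmann scalar bounded below,
against the Kerr worldline `r = 3M` inside a growing near zone); (ii) for every holeless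
such decomposition there are a focal event `x` on a future-complete normalised
null ray from the data (Prop. 3 + (H1)), an open neighbourhood `B` of `x` missing the flat image of
`{x⁰ > τ₁}` (Step 1: `C²`-convergence of the flat leaves), and a later achronal flat leaf
`Ψ₀({x⁰ = τ₂} ∩ U₀)`, `τ₀ < τ₂`, with `x` in its chronological future (Step 3, from (H2)).
`paper/focal-exceptional.md`, §3–§4. -/
def SoloBlindFocalInput (𝒟 : CauchyDevelopment D) [𝒟.metric.HasLeviCivita] : Prop :=
  -- Step 0: exhaustive decompositions of the self-determined exterior of `𝒟` have no holes.
  (∀ (O : Set 𝒟.carrier) (d : FinalStateDecomposition 𝒟.toSpacetime O 2),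
    O = exteriorOf 𝒟 d.charted → HasExhaustiveCharts d → d.N = 0) ∧
  -- Steps 1, 3 and Prop. 3: a separated focal event above a late achronal flat leaf.
  ∀ (O : Set 𝒟.carrier) (d : FinalStateDecomposition 𝒟.toSpacetime O 2), d.N = 0 →
    O = exteriorOf 𝒟 d.charted → HasExhaustiveCharts d →
      ∃ (x : 𝒟.carrier) (p : X) (γ : ℝ → 𝒟.carrier) (dom : Set ℝ) (t : ℝ),
        𝒟.metric.IsNormalisedNullRayFrom 𝒟.timeOrientation 𝒟.embed 𝒟.normal p γ dom ∧
        ¬ BddAbove dom ∧ t ∈ dom ∧ 0 ≤ t ∧ γ t = x ∧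
        ∃ (B : Set 𝒟.carrier) (τ₁ τ₂ : ℝ), IsOpen B ∧ x ∈ B ∧ d.τ₀ < τ₂ ∧ τ₁ ≤ τ₂ ∧
          Disjoint B (d.flatChart '' (Minkowski.backgroundOn d.flatDomain).lateRegion τ₁) ∧
          𝒟.metric.IsAchronal 𝒟.timeOrientation
            (d.flatChart '' (Minkowski.backgroundOn d.flatDomain).timeSlab τ₂) ∧
          x ∈ 𝒟.metric.chronologicalFuture 𝒟.timeOrientation
            (d.flatChart '' (Minkowski.backgroundOn d.flatDomain).timeSlab τ₂)

/-- **Theorem B (kernel form of its logic).** Under the focal input, the development `𝒟` carries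
NO final state decomposition `d` (in `C²`) of its self-determined exterior
`O = exteriorOf 𝒟 d.charted` satisfying the typed clauses `RaysStayInClosure` and
`HasExhaustiveCharts` — in particular not the conjunction demanded by the typed conclusion
(subextremal holes, `O = exteriorOf 𝒟 d.charted`, rays, exhaustion, orientation; subextremality
and orientation are not used).
`paper/focal-exceptional.md`, Theorem B; O'Neill 1983, Ch. 14, pp. 402–404, 413. -/
theorem soloBlind_focal_not_settles (𝒟 : CauchyDevelopment D) [𝒟.metric.HasLeviCivita]
    (H : SoloBlindFocalInput 𝒟) :
    ¬ ∃ (O : Set 𝒟.carrier) (d : FinalStateDecomposition 𝒟.toSpacetime O 2),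
        (∀ i, Kerr.IsSubextremal (d.mass i) (d.spin i)) ∧ O = exteriorOf 𝒟 d.charted ∧
          RaysStayInClosure 𝒟 O ∧ HasExhaustiveCharts d ∧ IsFutureOriented d := by
  rintro ⟨O, d, -, hO, hrays, hex, -⟩
  have hN := H.1 O d hO hex
  obtain ⟨x, p, γ, dom, t, hγ, hdom, ht, h0, hx, B, τ₁, τ₂, hB, hxB, h02, h12, hdisj, hA, hxI⟩ :=
    H.2 O d hN hO hex
  exact soloBlind_focal_contradiction 𝒟 d hN hrays hex hγ hdom ht h0 hx hB hxB h02 h12 hdisj hA hxI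

/-- **Corollary (the typed property `P` fails for the datum).** If some MAXIMAL vacuum Cauchy
development `𝒟` of `D` satisfies the focal input (for its Levi-Civita connection), then the
property asserted of generic data by `FinalStateConjecture` — an MGHD exists and EVERY MGHD has
complete null infinity and settles down in the typed sense — fails for `D`: its second conjunct
fails at `𝒟`. This is `¬ P(D₁)` of `paper/focal-exceptional.md`, Theorem B, with the analysis
(Prop. 3, (H1)–(H3), Steps 0, 1, 3) as the hypothesis `SoloBlindFocalInput`. -/
theorem soloBlind_focal_not_P (𝒟 : VacuumCauchyDevelopment D) (hmax : 𝒟.IsMaximal)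
    [𝒟.metric.HasLeviCivita] (H : SoloBlindFocalInput 𝒟.toCauchyDevelopment) :
    ¬ ((∃ 𝒟' : VacuumCauchyDevelopment D, 𝒟'.IsMaximal) ∧
        ∀ 𝒟' : VacuumCauchyDevelopment D, 𝒟'.IsMaximal →
          HasCompleteNullInfinity 𝒟'.toCauchyDevelopment ∧
            ∃ (O : Set 𝒟'.carrier) (d : FinalStateDecomposition 𝒟'.toSpacetime O 2),
              (∀ i, Kerr.IsSubextremal (d.mass i) (d.spin i)) ∧
                O = exteriorOf 𝒟'.toCauchyDevelopment d.charted ∧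
                  RaysStayInClosure 𝒟'.toCauchyDevelopment O ∧
                    HasExhaustiveCharts d ∧ IsFutureOriented d) := by
  rintro ⟨-, h⟩
  exact soloBlind_focal_not_settles 𝒟.toCauchyDevelopment H (h 𝒟 hmax).2

end Focal

end Summit.FinalStateConjecture.FinalStateConjecture.Theorems

end
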